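import Summits.Ventures.YMGap.Census.CharacterPowerExpansion
import HarnessLib

/-!
# Venture YMGap, track (b) — the potential-moving recursion preserves the positivity domain `f_c ≥ 0`

HONEST FRAMING: venture file of the cell `pub-ymgap` (QuantumFields programme), track (b); one-plaquette character
calculus.  Nothing here concerns (5.15), limits, confinement or a mass gap.

Tomboulis, arXiv:0707.2179 (2.34): "It is easily seen that `f_p(U, n) > 0` given that this holds for `n = 0`".  At the
kernel level, for the decimated coefficients `c^U_j(1,1) = ĉ_j^{b²}` of one step at `r = 1`:
`f_ĉ = f_c^ζ/F̂₀ ≥ 0` (`CharacterPowerExpansion.plaqFn_pow_eq`), and `f_{ĉ^k}` is the `k`-fold CONVOLUTION power of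
`f_ĉ` on `SU(2)` — `∫ f_a(h) f_c(h⁻¹g) dh = f_{a·c}(g)` by the face-merging rule
`∫ χ_m(h) χ_n(h⁻¹ g) dh = [m = n] χ_n(g)/(n+1)` (`LatticeQCDFlow.Scoring.integral_su2Character_mul_conv`) — hence
non-negative (`plaqFn_mul_coeff_nonneg`, `plaqFn_pow_coeff_nonneg`, **`plaqFn_mkCoeff_one_nonneg`**).  So Prop. III.1
on the positivity domain (`Decimation.decimationUpperBound_of_nonneg`) can be iterated.

References: E. T. Tomboulis, arXiv:0707.2179 §2.1 (2.34) [cite: Tomboulis2007Confinement, §2.1 (2.34)].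
-/

noncomputable section

open MeasureTheory Finset Real Function Polynomial.Chebyshev
open scoped BigOperators
open Literature.MathematicalPhysics.QuantumLattice
open Literature.MathematicalPhysics.QuantumFieldTheory
open Literature.MathematicalPhysics.QuantumFieldTheory.Tomboulis2007
open Summit.Ventures.LatticeQCDFlow.Exactness
open Summit.Ventures.LatticeQCDFlow.Scoring

namespace Summit.Ventures.YMGap.Census

/-- The plaquette function as a character sum of the group element: `f_c(g) = Σ_{n ≤ K} stdCoef(c)_n U_n(a₀(g))`. -/
theorem plaqFn_eq_sum_stdCoef (K : ℕ) (c : ℕ → ℝ) (g : SU2) :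
    plaqFn K c g = ∑ n ∈ Finset.range (K + 1), stdCoef c n * (U ℝ n).eval (su2a0 g) := by
  rw [plaqFn_eq_fR, ← charSum_stdCoef]
  unfold charSum
  simp only [charR_trace_eq_eval_su2a0]

/-- `stdCoef (a·c)_n · (n+1) = stdCoef(a)_n · stdCoef(c)_n`. -/
theorem stdCoef_mul (a c : ℕ → ℝ) (n : ℕ) :
    stdCoef (fun m => a m * c m) n = stdCoef a n * stdCoef c n / ((n : ℝ) + 1) := by
  unfold stdCoef
  have h : ((n : ℝ) + 1) ≠ 0 := by positivity
  split_ifs with hn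
  · subst hn; simp
  · field_simp

/-- **Convolution of plaquette functions multiplies the coefficients**: `∫ f_a(h) f_c(h⁻¹g) dh = f_{a·c}(g)`. -/
theorem integral_plaqFn_mul_plaqFn_conv (K : ℕ) (a c : ℕ → ℝ) (g : SU2) :
    ∫ h, plaqFn K a h * plaqFn K c (h⁻¹ * g) ∂(haarProbability SU2) = plaqFn K (fun n => a n * c n) g := by
  simp_rw [plaqFn_eq_sum_stdCoef]
  have hone : ∀ h : SU2, su2a0 h = su2a0 (1 * h) := fun h => by rw [one_mul]
  have hexp : ∀ h : SU2, (∑ m ∈ Finset.range (K + 1), stdCoef a m * (U ℝ m).eval (su2a0 h)) *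
      (∑ n ∈ Finset.range (K + 1), stdCoef c n * (U ℝ n).eval (su2a0 (h⁻¹ * g))) =
      ∑ m ∈ Finset.range (K + 1), ∑ n ∈ Finset.range (K + 1), stdCoef a m * stdCoef c n *
        ((U ℝ m).eval (su2a0 (1 * h)) * (U ℝ n).eval (su2a0 (h⁻¹ * g))) := by
    intro h
    rw [Finset.sum_mul_sum, ← hone]
    refine Finset.sum_congr rfl fun m _ => Finset.sum_congr rfl fun n _ => ?_
    ring
  simp_rw [hexp]
  have hint : ∀ m n : ℕ, Integrable (fun h : SU2 => stdCoef a m * stdCoef c n *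
      ((U ℝ m).eval (su2a0 (1 * h)) * (U ℝ n).eval (su2a0 (h⁻¹ * g)))) (haarProbability SU2) := fun m n =>
    (continuous_const.mul ((continuous_su2Character_comp m (continuous_const.mul continuous_id)).mul
      (continuous_su2Character_comp n (continuous_id.inv.mul continuous_const)))).integrable_of_hasCompactSupport
      (HasCompactSupport.of_compactSpace _)
  rw [integral_finsetSum _ fun m _ => integrable_finsetSum _ fun n _ => hint m n]
  simp_rw [integral_finsetSum _ fun n _ => hint _ n, integral_const_mul, integral_su2Character_mul_conv, one_mul]
  refine Finset.sum_congr rfl fun m hm => ?_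
  rw [Finset.sum_eq_single_of_mem m hm fun n _ hnm => by rw [if_neg (Ne.symm hnm), mul_zero], if_pos rfl, stdCoef_mul]
  ring

/-- **Positivity is preserved under coefficient products**: `f_a, f_c ≥ 0 ⟹ f_{a·c} ≥ 0`. -/
theorem plaqFn_mul_coeff_nonneg {K : ℕ} {a c : ℕ → ℝ} (ha : ∀ g : SU2, 0 ≤ plaqFn K a g)
    (hc : ∀ g : SU2, 0 ≤ plaqFn K c g) (g : SU2) : 0 ≤ plaqFn K (fun n => a n * c n) g := by
  rw [← integral_plaqFn_mul_plaqFn_conv]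
  exact integral_nonneg fun h => mul_nonneg (ha h) (hc _)

/-- `f_c ≥ 0 ⟹ f_{c^{k+1}} ≥ 0`. -/
theorem plaqFn_pow_coeff_nonneg {K : ℕ} {c : ℕ → ℝ} (hc : ∀ g : SU2, 0 ≤ plaqFn K c g) (k : ℕ) (g : SU2) :
    0 ≤ plaqFn K (fun n => c n ^ (k + 1)) g := by
  induction k generalizing g with
  | zero => simpa using hc g
  | succ k ih =>
    have h : (fun n => c n ^ (k + 1 + 1)) = fun n => c n ^ (k + 1) * c n := funext fun n => pow_succ _ _
    rw [h]
    exact plaqFn_mul_coeff_nonneg ih hc g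

/-- **`f_ĉ ≥ 0` on the positivity domain** (`f_ĉ = f_c^ζ/F̂₀`). -/
theorem plaqFn_hatCoeff_nonneg {J : ℕ} {c : ℕ → ℝ} (hc : ∀ n, 1 ≤ n → 0 ≤ c n) (hf : ∀ g : SU2, 0 ≤ plaqFn J c g)
    (ζ : ℕ) (g : SU2) : 0 ≤ plaqFn (ζ * J) (hatCoeff J c ζ) g := by
  have h := plaqFn_pow_eq (J := J) hc ζ g
  have hpos := mkFhat_zero_pos hc ζ (J := J)
  have h0 : 0 ≤ mkFhat J c ζ 0 * plaqFn (ζ * J) (hatCoeff J c ζ) g := by rw [← h]; exact pow_nonneg (hf g) ζ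
  exact (mul_nonneg_iff_of_pos_left hpos).1 h0

/-- **The potential-moving recursion at `r = 1` preserves the positivity domain**: `f_{c^U(1,1)} ≥ 0` whenever `f_c ≥ 0`
(arXiv:0707.2179 (2.34) at the kernel level). -/
theorem plaqFn_mkCoeff_one_nonneg {J : ℕ} {c : ℕ → ℝ} (hc : ∀ n, 1 ≤ n → 0 ≤ c n) (hf : ∀ g : SU2, 0 ≤ plaqFn J c g)
    (ζ b : ℕ) [NeZero b] (g : SU2) : 0 ≤ plaqFn (ζ * J) (mkCoeff J c ζ b 1) g := by
  have h : mkCoeff J c ζ b 1 = fun n => hatCoeff J c ζ n ^ (b ^ 2 - 1 + 1) := by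
    funext n
    rw [mkCoeff_one_eq_pow, Nat.sub_add_cancel (Nat.one_le_pow _ _ (Nat.pos_of_ne_zero (NeZero.ne b)))]
  rw [h]
  exact plaqFn_pow_coeff_nonneg (plaqFn_hatCoeff_nonneg hc hf ζ) _ g

end Summit.Ventures.YMGap.Census

end
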